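import Mathlib
import Literature.Probability.Percolation.CardyFormula
import Literature.Analysis.FunctionSpaces.DiagonalWeakLimits

/-!
# Stub `stub_diagonalCauchy` (S1a) of line `registered` of crux `SubseqCardy`
# (stmt-CriticalPhenomena-5768, route `CardyAnchoredRigidity`, sub-problem `CardyFormulaZ2`)

Pure analysis half of the tightness step S1 of the line: **countable uniform approximability of
the crossing functions implies a joint subsequential limit.** If a countable family
`Rk : ℕ → ConformalRectangle` approximates the bond-`ℤ²` crossing probability
`δ ↦ bondDomainCrossingProb R δ` of EVERY conformal rectangle `R` within any `ε > 0` for all small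
meshes `δ`, then along ONE sequence of meshes `u n → 0⁺` the crossing probabilities
`bondDomainCrossingProb R (u n)` of every conformal rectangle converge.

Proof (Arzelà–Ascoli style, Cantor's diagonal procedure plus an `ε/3` Cauchy argument):

* the countably many sequences `n ↦ bondDomainCrossingProb (Rk k) (1/(n+1))` are bounded by `1`
  (`Literature.Probability.Percolation.bondDomainCrossingProb_mem_Icc`), so a common subsequence
  `φ` makes all of them converge
  (`Literature.Analysis.FunctionSpaces.exists_strictMono_forall_tendsto_real`);
* the meshes `u n = 1/(φ n + 1)` tend to `0` from the right;
* for any rectangle `R`, the sequence `bondDomainCrossingProb R (u n)` is Cauchy: given `ε`, pick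
  `k` with `|p_R(δ) - p_{Rk k}(δ)| ≤ ε/3` for all small `δ > 0`, pull this back along `u`, and use
  that `n ↦ p_{Rk k}(u n)` converges (`exists_tendsto_comp_of_forall_approx`, the abstract
  form); completeness of `ℝ` gives the limit `g R`.
-/

namespace Summit.CriticalPhenomena.CardyFormulaZ2.Cruxes.SubseqCardy.Birth

open Filter Topology
open Literature.Probability.Percolation Literature.Probability.RandomPlanarGeometry

/-- **`ε/3` Cauchy argument, abstract form.** Let `u : ℕ → ℝ` tend to a filter `l`, and let the
real function `a` be approximated along `l` by members of a family `b k`: for every `ε > 0` some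
`k` has `|a δ - b k δ| ≤ ε` eventually along `l`. If every sequence `n ↦ b k (u n)` converges,
then so does `n ↦ a (u n)` (it is Cauchy: `ε/3` through a good `b k`; completeness of `ℝ`).
[folklore] -/
theorem exists_tendsto_comp_of_forall_approx {u : ℕ → ℝ} {l : Filter ℝ} (hu : Tendsto u atTop l)
    {a : ℝ → ℝ} {b : ℕ → ℝ → ℝ}
    (happrox : ∀ ε : ℝ, 0 < ε → ∃ k : ℕ, ∀ᶠ δ in l, |a δ - b k δ| ≤ ε)
    (hconv : ∀ k : ℕ, ∃ x : ℝ, Tendsto (fun n => b k (u n)) atTop (𝓝 x)) :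
    ∃ x : ℝ, Tendsto (fun n => a (u n)) atTop (𝓝 x) := by
  refine cauchySeq_tendsto_of_complete (Metric.cauchySeq_iff.2 fun ε hε => ?_)
  obtain ⟨k, hk⟩ := happrox (ε / 3) (by positivity)
  obtain ⟨x, hx⟩ := hconv k
  obtain ⟨N₁, hN₁⟩ := Metric.cauchySeq_iff.1 hx.cauchySeq (ε / 3) (by positivity)
  obtain ⟨N₂, hN₂⟩ := eventually_atTop.1 (hu.eventually hk)
  refine ⟨max N₁ N₂, fun m hm n hn => ?_⟩
  have hm₂ : |a (u m) - b k (u m)| ≤ ε / 3 := hN₂ m ((le_max_right _ _).trans hm)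
  have hn₂ : |a (u n) - b k (u n)| ≤ ε / 3 := hN₂ n ((le_max_right _ _).trans hn)
  calc dist (a (u m)) (a (u n))
      ≤ dist (a (u m)) (b k (u m)) + dist (b k (u m)) (b k (u n)) + dist (b k (u n)) (a (u n)) :=
        dist_triangle4 _ _ _ _
    _ < ε / 3 + ε / 3 + ε / 3 := by
        refine add_lt_add_of_lt_of_le (add_lt_add_of_le_of_lt ?_
          (hN₁ m ((le_max_left _ _).trans hm) n ((le_max_left _ _).trans hn))) ?_
        · rw [Real.dist_eq]
          exact hm₂
        · rw [dist_comm, Real.dist_eq]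
          exact hn₂
    _ = ε := by ring

/-- **The diagonal mesh sequence tends to `0⁺`.** For a strictly increasing `φ : ℕ → ℕ` the meshes
`1/(φ n + 1)` are positive and tend to `0`, i.e. tend to `0` within `(0, ∞)`. [folklore] -/
theorem tendsto_one_div_strictMono_add_one_nhdsWithin_Ioi {φ : ℕ → ℕ} (hφ : StrictMono φ) :
    Tendsto (fun n => 1 / ((φ n : ℝ) + 1)) atTop (𝓝[>] (0 : ℝ)) :=
  tendsto_nhdsWithin_iff.2
    ⟨(tendsto_one_div_add_atTop_nhds_zero_nat (𝕜 := ℝ)).comp hφ.tendsto_atTop,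
      Eventually.of_forall fun n => show (0 : ℝ) < 1 / ((φ n : ℝ) + 1) by positivity⟩

/-- **S1a `stub_diagonalCauchy` — countable uniform approximability ⇒ a joint subsequential limit**
(pure analysis; Arzelà–Ascoli-style diagonal extraction + Cauchy `ε/3`; in tree:
`Literature.Analysis.FunctionSpaces.exists_strictMono_forall_tendsto_real`,
`Literature.Probability.Percolation.bondDomainCrossingProb_mem_Icc`). If a countable family of conformal
rectangles approximates every rectangle's crossing probability within any `ε` for all small meshes,
then along ONE sequence of meshes `u n → 0⁺` the crossing probabilities of EVERY conformal rectangle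
converge. [folklore] -/
theorem stub_diagonalCauchy :
    (∃ Rk : ℕ → Literature.Probability.RandomPlanarGeometry.ConformalRectangle,
      ∀ (R : Literature.Probability.RandomPlanarGeometry.ConformalRectangle) (ε : ℝ), 0 < ε →
        ∃ k : ℕ, ∀ᶠ δ in nhdsWithin (0 : ℝ) (Set.Ioi 0),
          |Literature.Probability.Percolation.bondDomainCrossingProb R δ -
            Literature.Probability.Percolation.bondDomainCrossingProb (Rk k) δ| ≤ ε) →
    ∃ u : ℕ → ℝ, Filter.Tendsto u Filter.atTop (nhdsWithin (0 : ℝ) (Set.Ioi 0)) ∧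
      ∃ g : Literature.Probability.RandomPlanarGeometry.ConformalRectangle → ℝ,
        ∀ R : Literature.Probability.RandomPlanarGeometry.ConformalRectangle,
          Filter.Tendsto (fun n => Literature.Probability.Percolation.bondDomainCrossingProb R (u n))
            Filter.atTop (nhds (g R)) := by
  rintro ⟨Rk, hRk⟩
  -- (1) the countable family along the meshes `1/(n+1)` is bounded by `1`
  have hb : ∀ k : ℕ, ∃ C : ℝ, ∀ n : ℕ,
      |(fun (n k : ℕ) => bondDomainCrossingProb (Rk k) (1 / ((n : ℝ) + 1))) n k| ≤ C := by
    refine fun k => ⟨1, fun n => ?_⟩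
    obtain ⟨h0, h1⟩ := bondDomainCrossingProb_mem_Icc (Rk k) (1 / ((n : ℝ) + 1))
    exact abs_le.2 ⟨by linarith, h1⟩
  -- (2) diagonal extraction: a common convergent subsequence `φ`
  obtain ⟨φ, hφ, hlim⟩ :=
    Literature.Analysis.FunctionSpaces.exists_strictMono_forall_tendsto_real
      (fun (n k : ℕ) => bondDomainCrossingProb (Rk k) (1 / ((n : ℝ) + 1))) hb
  -- (3) the mesh sequence `u n = 1/(φ n + 1) → 0⁺`
  have hu : Tendsto (fun n => 1 / ((φ n : ℝ) + 1)) atTop (𝓝[>] (0 : ℝ)) :=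
    tendsto_one_div_strictMono_add_one_nhdsWithin_Ioi hφ
  -- (4) every rectangle's crossing probabilities are Cauchy along `u`, hence converge
  have hall : ∀ R : ConformalRectangle, ∃ x : ℝ,
      Tendsto (fun n => bondDomainCrossingProb R (1 / ((φ n : ℝ) + 1))) atTop (𝓝 x) := fun R =>
    exists_tendsto_comp_of_forall_approx hu (a := fun δ => bondDomainCrossingProb R δ)
      (b := fun k δ => bondDomainCrossingProb (Rk k) δ) (hRk R) hlim
  -- (5) the joint limit
  choose g hg using hall
  exact ⟨fun n => 1 / ((φ n : ℝ) + 1), hu, g, hg⟩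

end Summit.CriticalPhenomena.CardyFormulaZ2.Cruxes.SubseqCardy.Birth
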